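import Literature.Probability.RandomPlanarGeometry.SAWCountZdStirlingSecondCoefficient
import Literature.Probability.RandomPlanarGeometry.SAWCountZdSymbolSecondCoefficient
import HarnessLib

/-!
# SECOND CANCELLATION: given the two second-layer shape sums, the bad-word correction to the `j`-th `1/d`-symbol of `c_n(ℤ^d)` has degree at most `2j − 5`

Topic `Literature/Probability/RandomPlanarGeometry` (the «SYMBOL POLYNOMIALITY» programme; on `SAWCountZdSymbolFirstCancellation.lean` (a-p1 g26: `coeffPoly`,
`symbolMainPoly`, `symbolCorrPoly`, `stirlingPoly`, FIRST CANCELLATION `natDegree_symbolCorrPoly_le_sub_four`), `SAWCountZdStirlingSecondCoefficient.lean` (a-p1 g26: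
`coeff_stirlingPoly_two_mul_sub_one`), `SAWCountZdSymbolSecondCoefficient.lean` (a-p1 g26: `secondShapeSumTop/Below`, `coeff_symbolPoly_two_mul_sub_four_of_sums`),
λ4 `SAWCountZdSymbolLeadingCoefficient.lean` (a-p1 g25: `coeff_symbolPoly_two_mul_sub_three`, `natDegree_symbolPoly`); Mathlib `Polynomial.taylor`/`hasseDeriv`).

PRINTED CONTEXT (locators only; nothing is quoted digit-for-digit). Madras–Slade (1993) §1.1 eq. (1.1.8) p. 5, Definition 1.2.4, §1.2 p. 10; Clisby–Liang–Slade
(2007) §3.3 eqs. (29)/(31); Stanley EC1 §1.3 Prop. 1.3.7 eq. (1.28). NOT IN PRINT as far as the lane's desks could locate: the statements below.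

THE THEOREM. With `S_j = coeffPoly j = A_j − B_j` (`[X^{n−j}] P_n = 2^n S_j(n)`, `n ≥ 2j − 1`), `B_j = Σ_{i=2}^{j} R_i(X)·E_{j−i}(X − i)`: FIRST CANCELLATION gave
`deg B_j ≤ 2j − 4` (`j ≥ 3`). HERE, for every `j ≥ 4`, CONDITIONAL on the second-layer census closed forms `SecondLayerSums i` (`U'_i = (2i−4)(4i−7)(2i−5)‼2^{2i−3}`,
`3V'_i = (2i−4)(i+3)(2i−5)‼2^{2i−3}`) for `3 ≤ i ≤ j`: ★★★ `coeff_symbolCorrPoly_two_mul_sub_four_eq_zero` — **`[X^{2j−4}] B_j = 0`**; ★★★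
`natDegree_symbolCorrPoly_le_sub_five` — `deg B_j ≤ 2j − 5`; ★★ `natDegree_coeffPoly_le_of_secondLayer` — `deg S_j ≤ max(j, 2j − 5)`. MECHANISM (all `j`): the
`i`-th summand's `X^{2j−4}` coefficient is leading × second + second × leading (`coeff_mul_natDegree_add_sub_one`, Taylor `coeff_comp_X_add_C_natDegree_sub_one`) =
`T(i−2, j−i) = (−1)^{j−i+1}[(2j+3)(j−1) + (2j−3)i]/(3·2^j (i−2)!(j−i)!)` (`secondTermVal`; `coeff_term_self`, `coeff_term_lt`) — LINEAR in `i` — and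
`Σ_m (−1)^m C(N,m) = Σ_m (−1)^m m C(N,m) = 0` for `N = j − 2 ≥ 2` (`alternating_sum_choose_eq_zero`, `alternating_sum_mul_choose_eq_zero`) kill it
(`sum_secondTermVal_eq_zero`). So the second of the `j − 3` cancellations predicted by the STRUCTURE CONJECTURE «`deg P_j = j`» (FINDING-ZD-FOURTH-SYMBOL §8) is reduced,
for all `j` at once, to two explicit shape counts (kernel facts for `j ≤ 7`; blind predictions registered as «Am. BQ», FINDING-ZD-SYMBOL-POLYNOMIALITY §15).
Tool notions (the lane's): `secondTermVal`, `SecondLayerSums`.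

THIS FILE (lane «pcv-sawmu», a-p1 g26; all PROVED, standard axioms; the four generic polynomial/binomial helpers are private): `coeff_mul_natDegree_add_sub_one`,
`coeff_comp_X_add_C_natDegree_sub_one`, `alternating_sum_choose_eq_zero`, `alternating_sum_mul_choose_eq_zero` (private), `secondShapeSumTop_two`, `secondShapeSumBelow_two`, `secondTermVal`, `SecondLayerSums`, `secondLayerSums_two`, `coeff_term_self`,
`coeff_term_lt`, ★ `sum_secondTermVal_eq_zero`, ★★★ `coeff_symbolCorrPoly_two_mul_sub_four_eq_zero`, ★★★ `natDegree_symbolCorrPoly_le_sub_five`, ★★ `natDegree_coeffPoly_le_of_secondLayer`.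
[cite: MadrasSlade1993, §1.1 eq. (1.1.8) p. 5; Definition 1.2.4; §1.2 (p. 10)] [cite: ClisbyLiangSlade2007, §3.3 eqs. (29)/(31)] [cite: Stanley2012EC1, §1.3 Prop. 1.3.7 eq. (1.28)]

Provenance: lane «pcv-sawmu», a-p1 g26 (2026-08-28).
-/

noncomputable section

open Finset
open scoped BigOperators
open Literature.Probability.LatticeModels
open Literature.Probability.RandomPlanarGeometry.SAW
open Literature.Probability.Percolation

namespace Literature.Probability.RandomPlanarGeometry.SAW.Zd

namespace WordTypes

/-! ### Two polynomial plumbing lemmas: the second coefficient of a product and of a shift -/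

/-- `[X^{dp + dq − 1}] (p·q) = p_{dp−1}·q_{dq} + p_{dp}·q_{dq−1}` for `natDegree p = dp ≥ 1`, `natDegree q = dq ≥ 1`.
[cite: Stanley2012EC1, §1.3 Prop. 1.3.7 eq. (1.28); lane plumbing] -/
private theorem coeff_mul_natDegree_add_sub_one (p q : Polynomial ℚ) {dp dq : ℕ} (hp : p.natDegree = dp + 1) (hq : q.natDegree = dq + 1) :
    (p * q).coeff (dp + dq + 1) = p.coeff dp * q.coeff (dq + 1) + p.coeff (dp + 1) * q.coeff dq := by
  have hsplit : p = p.eraseLead + Polynomial.C p.leadingCoeff * Polynomial.X ^ (dp + 1) := by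
    rw [← hp, Polynomial.eraseLead_add_C_mul_X_pow]
  have he : p.eraseLead.natDegree ≤ dp := by
    have := Polynomial.eraseLead_natDegree_le p; rw [hp] at this; omega
  conv_lhs => rw [hsplit]
  rw [add_mul, Polynomial.coeff_add, show dp + dq + 1 = dp + (dq + 1) by ring,
    Polynomial.coeff_mul_add_eq_of_natDegree_le he (by rw [hq]), mul_assoc, Polynomial.coeff_C_mul, Polynomial.coeff_X_pow_mul',
    if_pos (by omega), show dp + (dq + 1) - (dp + 1) = dq by omega, Polynomial.eraseLead_coeff_of_ne _ (by rw [hp]; omega),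
    Polynomial.leadingCoeff, hp]

/-- `[X^{d−1}] p(X + c) = p_{d−1} + d·c·p_d` for `natDegree p = d ≥ 1` (Taylor). [cite: Stanley2012EC1, §1.3 Prop. 1.3.7 eq. (1.28); lane plumbing] -/
private theorem coeff_comp_X_add_C_natDegree_sub_one (p : Polynomial ℚ) {d : ℕ} (hp : p.natDegree = d + 1) (c : ℚ) :
    (p.comp (Polynomial.X + Polynomial.C c)).coeff d = p.coeff d + ((d : ℚ) + 1) * c * p.coeff (d + 1) := by
  rw [← Polynomial.taylor_apply, Polynomial.taylor_coeff]
  have hdeg : (Polynomial.hasseDeriv d p).natDegree < 2 := by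
    have := Polynomial.natDegree_hasseDeriv_le p d; rw [hp] at this; omega
  rw [Polynomial.eval_eq_sum_range' hdeg, Finset.sum_range_succ, Finset.sum_range_succ, Finset.sum_range_zero, zero_add,
    Polynomial.hasseDeriv_coeff, Polynomial.hasseDeriv_coeff, zero_add, Nat.choose_self, show 1 + d = d + 1 by ring, Nat.choose_succ_self_right]
  push_cast
  ring

/-! ### The alternating binomial sums -/

/-- `Σ_m (−1)^m C(N,m) = 0` for `N ≥ 1`. [cite: Stanley2012EC1, §1.3 Prop. 1.3.7 eq. (1.28); lane plumbing] -/
private theorem alternating_sum_choose_eq_zero (N : ℕ) (hN : 1 ≤ N) :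
    ∑ m ∈ Finset.range (N + 1), ((-1 : ℚ) ^ m * (N.choose m : ℕ)) = 0 := by
  have h := add_pow (-1 : ℚ) 1 N
  simp only [one_pow, mul_one] at h
  rw [← h, show (-1 : ℚ) + 1 = 0 by norm_num, zero_pow (by omega)]

/-- `Σ_m (−1)^m m C(N,m) = 0` for `N ≥ 2` (`m C(N,m) = N C(N−1,m−1)`). [cite: Stanley2012EC1, §1.3 Prop. 1.3.7 eq. (1.28); lane plumbing] -/
private theorem alternating_sum_mul_choose_eq_zero (N : ℕ) (hN : 2 ≤ N) :
    ∑ m ∈ Finset.range (N + 1), ((-1 : ℚ) ^ m * m * (N.choose m : ℕ)) = 0 := by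
  obtain ⟨n, rfl⟩ : ∃ n, N = n + 1 := ⟨N - 1, by omega⟩
  rw [Finset.sum_range_succ', Nat.cast_zero, mul_zero, zero_mul, add_zero]
  have h : ∀ m ∈ Finset.range (n + 1), ((-1 : ℚ) ^ (m + 1) * ((m + 1 : ℕ) : ℚ) * ((n + 1).choose (m + 1) : ℕ)) =
      -((n : ℚ) + 1) * ((-1 : ℚ) ^ m * (n.choose m : ℕ)) := by
    intro m _
    have hnat := Nat.add_one_mul_choose_eq n m
    have hq : ((n : ℚ) + 1) * (n.choose m : ℕ) = (((n + 1).choose (m + 1) : ℕ) : ℚ) * ((m : ℚ) + 1) := by exact_mod_cast hnat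
    have hc : (((n + 1).choose (m + 1) : ℕ) : ℚ) * ((m : ℚ) + 1) = ((n : ℚ) + 1) * (n.choose m : ℕ) := hq.symm
    rw [pow_succ]
    push_cast
    linear_combination (-1 : ℚ) ^ m * (-1) * hc
  simp_rw [Nat.cast_succ] at h ⊢
  rw [Finset.sum_congr rfl (fun m hm => h m hm), ← Finset.mul_sum, alternating_sum_choose_eq_zero n (by omega), mul_zero]

/-! ### The second-layer shape sums at `j = 2` vanish (a valid adjacency vector has a break) -/

/-- `U'_2 = 0`. [cite: MadrasSlade1993, Definition 1.2.4; lane plumbing] -/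
theorem secondShapeSumTop_two : secondShapeSumTop 2 = 0 := by
  classical
  unfold secondShapeSumTop
  refine Finset.sum_eq_zero fun A _ => ?_
  split_ifs with h
  · exact absurd h.2 (by have := breaks_pos_of_valid h.1 (by norm_num); omega)
  · rfl

/-- `V'_2 = 0`. [cite: MadrasSlade1993, Definition 1.2.4; lane plumbing] -/
theorem secondShapeSumBelow_two : secondShapeSumBelow 2 = 0 := by
  classical
  unfold secondShapeSumBelow
  refine Finset.sum_eq_zero fun A _ => ?_
  split_ifs with h
  · exact absurd h.2 (by have := breaks_pos_of_valid h.1 (by norm_num); omega)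
  · rfl

/-! ### The summands of `B_j` one below their top -/

/-- The uniform value of the `X^{2j−4}`-coefficient of the `i`-th summand `R_i · E_{j−i}(X − i)` of `B_j` under the second-layer closed forms, written
in `m = i − 2`, `k = j − i`: `T(m,k) = (−1)^{k+1}·[(2j+3)(j−1) + (2j−3)i]/(3·2^j·m!·k!)`. [cite: MadrasSlade1993, §1.1 eq. (1.1.8) p. 5; lane tool notion] -/
def secondTermVal (m k : ℕ) : ℚ :=
  (-1) ^ (k + 1) * ((2 * ((m : ℚ) + 2 + k) + 3) * ((m : ℚ) + 2 + k - 1) + (2 * ((m : ℚ) + 2 + k) - 3) * ((m : ℚ) + 2)) /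
    (3 * 2 ^ (m + 2 + k) * ((m.factorial : ℚ) * (k.factorial : ℚ)))

/-- The second-layer hypothesis on the shape sums at order `i`: `U'_i` and `V'_i` have the predicted closed forms.
[cite: MadrasSlade1993, Definition 1.2.4; lane tool notion] -/
def SecondLayerSums (i : ℕ) : Prop :=
  secondShapeSumTop i = (2 * i - 4) * (4 * i - 7) * ((2 * i - 5).doubleFactorial * 2 ^ (2 * i - 3)) ∧
    3 * secondShapeSumBelow i = (2 * i - 4) * (i + 3) * ((2 * i - 5).doubleFactorial * 2 ^ (2 * i - 3))

/-- The hypothesis holds at `i = 2` (both sides vanish). [cite: MadrasSlade1993, Definition 1.2.4; lane plumbing] -/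
theorem secondLayerSums_two : SecondLayerSums 2 := by
  unfold SecondLayerSums
  rw [secondShapeSumTop_two, secondShapeSumBelow_two]
  norm_num

/-- The `i = j` summand (`E₀ = 1`): `[X^{2j−4}] R_j = T(j−2, 0)` under `SecondLayerSums j`. [cite: MadrasSlade1993, §1.1 eq. (1.1.8) p. 5; lane lemma] -/
theorem coeff_term_self (m : ℕ) (h : SecondLayerSums (m + 2)) :
    (symbolPoly (m + 2) * (stirlingPoly (m + 2 - (m + 2))).comp (Polynomial.X - Polynomial.C ((m + 2 : ℕ) : ℚ))).coeff (2 * (m + 2) - 4) =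
      secondTermVal m 0 := by
  rw [Nat.sub_self, stirlingPoly_zero, Polynomial.one_comp, mul_one, coeff_symbolPoly_two_mul_sub_four_of_sums (m + 2) (by omega) h.1 h.2,
    secondTermVal, show m + 2 - 2 = m by omega]
  push_cast
  have hf : (m.factorial : ℚ) ≠ 0 := by exact_mod_cast m.factorial_ne_zero
  rw [Nat.factorial_zero, Nat.cast_one]
  field_simp
  ring

/-- The `i < j` summands: `[X^{2j−4}] (R_i · E_k(X − i)) = T(i−2, k)` (`k = j − i ≥ 1`) under `SecondLayerSums i` — leading × second plus second × leading.
[cite: MadrasSlade1993, §1.1 eq. (1.1.8) p. 5; lane lemma] -/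
theorem coeff_term_lt (m k : ℕ) (hk : 1 ≤ k) (h : SecondLayerSums (m + 2)) :
    (symbolPoly (m + 2) * (stirlingPoly (m + 2 + k - (m + 2))).comp (Polynomial.X - Polynomial.C ((m + 2 : ℕ) : ℚ))).coeff (2 * (m + 2 + k) - 4) =
      secondTermVal m k := by
  obtain ⟨k, rfl⟩ : ∃ k', k = k' + 1 := ⟨k - 1, by omega⟩
  rw [show m + 2 + (k + 1) - (m + 2) = k + 1 by omega]
  set G : Polynomial ℚ := (stirlingPoly (k + 1)).comp (Polynomial.X - Polynomial.C ((m + 2 : ℕ) : ℚ)) with hG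
  have hGX : Polynomial.X - Polynomial.C ((m + 2 : ℕ) : ℚ) = Polynomial.X + Polynomial.C (-(((m + 2 : ℕ) : ℚ))) := by
    rw [map_neg, sub_eq_add_neg]
  have hRdeg : (symbolPoly (m + 2)).natDegree = 2 * m + 1 := by rw [natDegree_symbolPoly (m + 2) (by omega)]; omega
  have hGdeg : G.natDegree = 2 * k + 1 + 1 := by
    rw [hG, Polynomial.natDegree_comp, natDegree_stirlingPoly, Polynomial.natDegree_X_sub_C]; ring
  have hGlc : G.coeff (2 * k + 1 + 1) = (-1) ^ (k + 1) / (2 ^ (k + 1) * ((k + 1).factorial : ℚ)) := by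
    have : G.leadingCoeff = (stirlingPoly (k + 1)).leadingCoeff := by
      rw [hG, Polynomial.leadingCoeff_comp (by rw [Polynomial.natDegree_X_sub_C]; exact one_ne_zero),
        (Polynomial.monic_X_sub_C _).leadingCoeff, one_pow, mul_one]
    rw [Polynomial.leadingCoeff, hGdeg, leadingCoeff_stirlingPoly] at this
    exact this
  have hGsub : G.coeff (2 * k + 1) = (-1) ^ (k + 1 + 1) * (((k + 1 : ℕ) : ℚ) * (2 * ((k + 1 : ℕ) : ℚ) + 1)) / (3 * 2 ^ (k + 1) * ((k + 1).factorial : ℚ))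
      + ((2 * k + 1 : ℕ) + 1 : ℚ) * (-(((m + 2 : ℕ) : ℚ))) * ((-1) ^ (k + 1) / (2 ^ (k + 1) * ((k + 1).factorial : ℚ))) := by
    have hE : (stirlingPoly (k + 1)).natDegree = (2 * k + 1) + 1 := by rw [natDegree_stirlingPoly]; ring
    rw [hG, hGX, coeff_comp_X_add_C_natDegree_sub_one _ hE, show 2 * k + 1 = 2 * (k + 1) - 1 by omega,
      coeff_stirlingPoly_two_mul_sub_one (k + 1) (by omega), show 2 * (k + 1) - 1 + 1 = 2 * (k + 1) by omega,
      (natDegree_stirlingPoly_le_and_coeff (k + 1)).2]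
  have hRlc : (symbolPoly (m + 2)).coeff (2 * m + 1) = (1 / 2) ^ (m + 2) / (m.factorial : ℚ) := by
    rw [show 2 * m + 1 = 2 * (m + 2) - 3 by omega, coeff_symbolPoly_two_mul_sub_three (m + 2) (by omega), show m + 2 - 2 = m by omega]
  have hRsub : (symbolPoly (m + 2)).coeff (2 * m) = -((4 * ((m : ℚ) + 2) ^ 2 - 2 * ((m : ℚ) + 2) - 3) / (3 * 2 ^ (m + 2) * (m.factorial : ℚ))) := by
    rw [show 2 * m = 2 * (m + 2) - 4 by omega, coeff_symbolPoly_two_mul_sub_four_of_sums (m + 2) (by omega) h.1 h.2, show m + 2 - 2 = m by omega]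
    push_cast; ring
  rw [show 2 * (m + 2 + (k + 1)) - 4 = 2 * m + (2 * k + 1) + 1 by omega, coeff_mul_natDegree_add_sub_one _ _ hRdeg hGdeg, hRsub, hGlc, hRlc, hGsub,
    secondTermVal, Nat.factorial_succ]
  push_cast
  have hf : (m.factorial : ℚ) ≠ 0 := by exact_mod_cast m.factorial_ne_zero
  have hkf : (k.factorial : ℚ) ≠ 0 := by exact_mod_cast k.factorial_ne_zero
  simp only [one_div, inv_pow]
  field_simp
  ring

/-! ### ★★★ The second cancellation -/

/-- The reindexed sum vanishes: `Σ_{m ≤ N} T(m, N − m) = 0` for `N ≥ 2` (the bracket is linear in `m`; two alternating binomial sums).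
[cite: MadrasSlade1993, §1.1 eq. (1.1.8) p. 5; lane lemma] -/
theorem sum_secondTermVal_eq_zero (N : ℕ) (hN : 2 ≤ N) : ∑ m ∈ Finset.range (N + 1), secondTermVal m (N - m) = 0 := by
  -- `T(m, N−m) · (3·2^{N+2}·N!) · (−1)^{N+1} = (−1)^m C(N,m) (A + B m)` with `A = (2j+3)(j−1) + 2(2j−3)`, `B = 2j − 3`, `j = N + 2`
  set A : ℚ := (2 * ((N : ℚ) + 2) + 3) * ((N : ℚ) + 1) + (2 * ((N : ℚ) + 2) - 3) * 2 with hA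
  set B : ℚ := 2 * ((N : ℚ) + 2) - 3 with hB
  have hterm : ∀ m ∈ Finset.range (N + 1), secondTermVal m (N - m) =
      (-1) ^ (N + 1) / (3 * 2 ^ (N + 2) * (N.factorial : ℚ)) * ((-1 : ℚ) ^ m * (N.choose m : ℕ) * (A + B * m)) := by
    intro m hm
    have hmN : m ≤ N := by have := Finset.mem_range.1 hm; omega
    rw [secondTermVal, Nat.cast_choose ℚ hmN]
    have hcast : ((m : ℚ) + 2 + ((N - m : ℕ) : ℚ)) = (N : ℚ) + 2 := by rw [Nat.cast_sub hmN]; ring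
    have hpow2 : (2 : ℚ) ^ (m + 2 + (N - m)) = 2 ^ (N + 2) := by rw [show m + 2 + (N - m) = N + 2 by omega]
    have hsign : (-1 : ℚ) ^ (N - m + 1) = (-1) ^ (N + 1) * (-1) ^ m := by
      have h1 : (-1 : ℚ) ^ (N - m + 1) * (-1) ^ m = (-1) ^ (N + 1) := by rw [← pow_add]; congr 1; omega
      have h2 : (-1 : ℚ) ^ m * (-1) ^ m = 1 := by rw [← mul_pow]; norm_num
      calc (-1 : ℚ) ^ (N - m + 1) = (-1) ^ (N - m + 1) * ((-1) ^ m * (-1) ^ m) := by rw [h2, mul_one]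
        _ = (-1) ^ (N + 1) * (-1) ^ m := by rw [← mul_assoc, h1]
    rw [hcast, hpow2, hsign, hA, hB]
    have hf1 : (m.factorial : ℚ) ≠ 0 := by exact_mod_cast m.factorial_ne_zero
    have hf2 : ((N - m).factorial : ℚ) ≠ 0 := by exact_mod_cast (N - m).factorial_ne_zero
    have hf3 : (N.factorial : ℚ) ≠ 0 := by exact_mod_cast N.factorial_ne_zero
    field_simp
    ring
  rw [Finset.sum_congr rfl hterm, ← Finset.mul_sum]
  have hsum : ∑ m ∈ Finset.range (N + 1), ((-1 : ℚ) ^ m * (N.choose m : ℕ) * (A + B * m)) = 0 := by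
    have : ∀ m ∈ Finset.range (N + 1), ((-1 : ℚ) ^ m * (N.choose m : ℕ) * (A + B * m)) =
        A * ((-1 : ℚ) ^ m * (N.choose m : ℕ)) + B * ((-1 : ℚ) ^ m * m * (N.choose m : ℕ)) := by intro m _; ring
    rw [Finset.sum_congr rfl this, Finset.sum_add_distrib, ← Finset.mul_sum, ← Finset.mul_sum, alternating_sum_choose_eq_zero N (by omega),
      alternating_sum_mul_choose_eq_zero N hN, mul_zero, mul_zero, add_zero]
  rw [hsum, mul_zero]

/-- ★★★ SECOND CANCELLATION (conditional on the second-layer shape sums): for every `j ≥ 4`, if `U'_i = (2i−4)(4i−7)(2i−5)‼2^{2i−3}` and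
`3V'_i = (2i−4)(i+3)(2i−5)‼2^{2i−3}` for all `3 ≤ i ≤ j` (kernel-census facts for `i ≤ 7`; FINDING-ZD-SYMBOL-POLYNOMIALITY §15), then the `X^{2j−4}`-coefficient
of the bad-word correction `B_j = Σ_{i=2}^{j} R_i(X) E_{j−i}(X−i)` VANISHES — the summands' `X^{2j−4}` coefficients are
`(−1)^{j−i+1}[(2j+3)(j−1) + (2j−3)i]/(3·2^j (i−2)!(j−i)!)`, LINEAR in `i`, and the alternating binomial sums kill them.
[cite: MadrasSlade1993, §1.1 eq. (1.1.8) p. 5; Definition 1.2.4] [cite: ClisbyLiangSlade2007, §3.3 eqs. (29)/(31); lane theorem] -/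
theorem coeff_symbolCorrPoly_two_mul_sub_four_eq_zero (j : ℕ) (hj : 4 ≤ j) (h : ∀ i, 3 ≤ i → i ≤ j → SecondLayerSums i) :
    (symbolCorrPoly j).coeff (2 * j - 4) = 0 := by
  obtain ⟨N, rfl⟩ : ∃ N, j = N + 2 := ⟨j - 2, by omega⟩
  have hall : ∀ m, m ≤ N → SecondLayerSums (m + 2) := by
    intro m hm
    rcases Nat.eq_zero_or_pos m with rfl | hpos
    · exact secondLayerSums_two
    · exact h (m + 2) (by omega) (by omega)
  unfold symbolCorrPoly
  rw [Polynomial.finsetSum_coeff]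
  have himage : Finset.Ico 2 (N + 2 + 1) = (Finset.range (N + 1)).image (fun m => m + 2) := by
    ext i; simp only [Finset.mem_Ico, Finset.mem_image, Finset.mem_range]; constructor
    · intro hi; exact ⟨i - 2, by omega, by omega⟩
    · rintro ⟨m, hm, rfl⟩; omega
  rw [himage, Finset.sum_image (fun a _ b _ h => by omega)]
  rw [← sum_secondTermVal_eq_zero N (by omega)]
  refine Finset.sum_congr rfl fun m hm => ?_
  have hmN : m ≤ N := by have := Finset.mem_range.1 hm; omega
  rcases Nat.eq_or_lt_of_le hmN with rfl | hlt
  · have := coeff_term_self m (hall m le_rfl)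
    simp only [Nat.sub_self] at this ⊢
    exact this
  · have := coeff_term_lt m (N - m) (by omega) (hall m hmN)
    rw [show m + 2 + (N - m) = N + 2 by omega] at this
    exact this

/-- ★★★ Hence, under the same census hypotheses, `deg B_j ≤ 2j − 5` for every `j ≥ 4` (after FIRST CANCELLATION's `≤ 2j − 4`), and so
`deg S_j ≤ max(j, 2j − 5)` — the second of the `j − 3` cancellations predicted by the STRUCTURE CONJECTURE «`deg P_j = j`», reduced for all `j` to two
explicit shape counts. [cite: MadrasSlade1993, §1.1 eq. (1.1.8) p. 5; Definition 1.2.4] [cite: ClisbyLiangSlade2007, §3.3 eqs. (29)/(31); lane theorem] -/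
theorem natDegree_symbolCorrPoly_le_sub_five (j : ℕ) (hj : 4 ≤ j) (h : ∀ i, 3 ≤ i → i ≤ j → SecondLayerSums i) :
    (symbolCorrPoly j).natDegree ≤ 2 * j - 5 := by
  have hle := natDegree_symbolCorrPoly_le_sub_four j (by omega)
  by_contra hlt
  have heq : (symbolCorrPoly j).natDegree = 2 * j - 4 := by omega
  have hne : symbolCorrPoly j ≠ 0 := by
    intro h0; rw [h0, Polynomial.natDegree_zero] at heq; omega
  have := Polynomial.leadingCoeff_ne_zero.2 hne
  rw [Polynomial.leadingCoeff, heq, coeff_symbolCorrPoly_two_mul_sub_four_eq_zero j hj h] at this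
  exact this rfl

/-- ★★ And `deg S_j ≤ max(j, 2j − 5)` (`j ≥ 4`) under the census hypotheses — sharp for `j ≤ 5` (`P₅` has degree `5`).
[cite: MadrasSlade1993, §1.1 eq. (1.1.8) p. 5; Definition 1.2.4] [cite: ClisbyLiangSlade2007, §3.3 eqs. (29)/(31); lane theorem] -/
theorem natDegree_coeffPoly_le_of_secondLayer (j : ℕ) (hj : 4 ≤ j) (h : ∀ i, 3 ≤ i → i ≤ j → SecondLayerSums i) :
    (coeffPoly j).natDegree ≤ max j (2 * j - 5) := by
  rw [coeffPoly]
  refine (Polynomial.natDegree_sub_le _ _).trans (max_le ?_ ?_)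
  · rw [natDegree_symbolMainPoly]; exact le_max_left _ _
  · exact (natDegree_symbolCorrPoly_le_sub_five j hj h).trans (le_max_right _ _)

end WordTypes

end Literature.Probability.RandomPlanarGeometry.SAW.Zd
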